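import Literature.Geometry.Symplectic.OrigamiCollarMoserData
import Literature.Geometry.Symplectic.OrigamiMoserInvariance
import Literature.Geometry.Symplectic.OrigamiCollarNormalForm
import Literature.Geometry.Symplectic.OrigamiFoldCollarData
import Literature.Geometry.Symplectic.OrigamiCollarModelAgreement
import Literature.Geometry.Symplectic.OrigamiFoldNullLine
import Literature.Geometry.Symplectic.CircleConnectionForm
import Literature.Geometry.Manifold.InjOnLocalDiffeomorphInverse
import HarnessLib

/-!
# The origami normal form of the fold (discharge of `exists_origamiCollarNormalForm`)

Eleventh and last file of the proof of the named fact
`Literature.Geometry.Symplectic.exists_origamiCollarNormalForm` (Cannas da Silva–Guillemin–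
Woodward, *On the unfolding of folded symplectic structures*, Math. Res. Lett. 7 (2000),
Thm. 1, as used by Cannas da Silva–Guillemin–Pires 2010, proof of Prop. 2.8), by the Moser
argument of its printed proof:

* from the kernel-adapted collar `c₀ = foldCollar U j` of the fold
  (`IsOrigamiForm.exists_kernelAdaptedCollar`) and the null circle action re-oriented
  component-wise so that the first-order coefficient is positive (`flipAct`), with a connection
  form `α` (`exists_circleConnectionForm`), the Moser data of the segment from `c₀^*ω` to the
  model form `ω₁ = pr^*i^*ω + d(t² pr^*α)` (`exists_moserData_of_collar`);
* the Moser isotopy `Ψ` (`OrigamiMoserFlow.lean`) with `Ψ₁^* ω₁ = c₀^*ω` on a thin band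
  (`pullback_isotopy_one`, `OrigamiMoserInvariance.lean`), fixing the zero section and
  preserving the sign of `t` along tracks (`isotopy_snd_pos_iff`);
* the collar `c = c₀ ∘ Ψ₁⁻¹` in origami normal form with all the clauses of the fact:
  **`exists_origamiCollarNormalForm_holds`**.

Everything here is proved; no facts.

## References

* A. Cannas da Silva, V. Guillemin, C. Woodward, *On the unfolding of folded symplectic
  structures*, Math. Res. Lett. 7 (2000) 35–53, Thm. 1. [CannasGuilleminWoodward2000]
* A. Cannas da Silva, V. Guillemin, A. R. Pires, *Symplectic Origami*, IMRN 2011 =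
  arXiv:0909.4065, proof of Prop. 2.8. [CannasdasilvaGuilleminPires2010]
-/

noncomputable section

universe u

open scoped Manifold ContDiff Topology
open Set Function Filter
open Literature.Geometry.Kaehler Literature.Geometry.Manifold Literature.Topology.FourManifolds

namespace Literature.Geometry.Symplectic

namespace OrigamiMoser

local notation "E3" => EuclideanSpace ℝ (Fin 3)
local notation "F4" => EuclideanSpace ℝ (Fin 3) × ℝ
local notation "I34" => ModelWithCorners.prod (𝓡 3) 𝓘(ℝ, ℝ)

namespace MoserData

variable {N : Type*} [TopologicalSpace N] [ChartedSpace (EuclideanSpace ℝ (Fin 3)) N]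
  [IsManifold (𝓡 3) ∞ N] [CompactSpace N] [T2Space N] (D : MoserData N)

/-- **Tracks of the Moser isotopy do not cross the zero section**, which is fixed pointwise: the
sign of the `t`-coordinate is preserved. [folklore] -/
theorem isotopy_snd_pos_iff (s : ℝ) (z : N × ℝ) : 0 < (D.isotopy.toFun s z).2 ↔ 0 < z.2 := by
  set γ : ℝ → ℝ := fun τ => (D.isotopy.toFun τ z).2 with hγ
  have hγc : Continuous γ :=
    continuous_snd.comp (D.isotopy.contMDiff.continuous.comp (continuous_id.prodMk continuous_const))
  have hγ0 : γ 0 = z.2 := by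
    show (D.isotopy.toFun 0 z).2 = z.2
    rw [D.isotopy.map_zero]; rfl
  by_cases hz : z.2 = 0
  · -- a point of the zero section does not move
    have hzz : z = (z.1, 0) := by ext <;> simp [hz]
    have : D.isotopy.toFun s z = z := by rw [hzz]; exact D.isotopy_zero_section s z.1
    rw [this]
  · -- the track never meets the zero section
    have hne : ∀ τ, γ τ ≠ 0 := by
      intro τ h0
      have h0' : (D.isotopy.toFun τ z).2 = 0 := h0
      have h1 : D.isotopy.toFun τ z = ((D.isotopy.toFun τ z).1, 0) := by ext <;> simp [h0']
      have h2 : D.isotopy.toFun τ z = D.isotopy.toFun τ ((D.isotopy.toFun τ z).1, 0) := by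
        rw [D.isotopy_zero_section]; exact h1
      have h3 := (D.isotopy.bijective τ).1 h2
      apply hz
      rw [h3]
    have key : ∀ {u v : ℝ}, 0 < γ u → ¬ γ v < 0 := by
      intro u v hu hv
      rcases le_total u v with huv | hvu
      · obtain ⟨τ, -, hτ⟩ := intermediate_value_Icc' huv hγc.continuousOn ⟨hv.le, hu.le⟩
        exact hne τ hτ
      · obtain ⟨τ, -, hτ⟩ := intermediate_value_Icc hvu hγc.continuousOn ⟨hv.le, hu.le⟩
        exact hne τ hτ
    rw [← hγ0]
    show 0 < γ s ↔ 0 < γ 0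
    constructor
    · intro h
      rcases lt_trichotomy (γ 0) 0 with h0 | h0 | h0
      · exact absurd h0 (key h)
      · exact absurd h0 (hne 0)
      · exact h0
    · intro h
      rcases lt_trichotomy (γ s) 0 with h0 | h0 | h0
      · exact absurd h0 (key h)
      · exact absurd h0 (hne s)
      · exact h0

/-- The sign of the `t`-coordinate is preserved (negative side). [folklore] -/
theorem isotopy_snd_neg_iff (s : ℝ) (z : N × ℝ) : (D.isotopy.toFun s z).2 < 0 ↔ z.2 < 0 := by
  have hpos := D.isotopy_snd_pos_iff s z
  have hzero : (D.isotopy.toFun s z).2 = 0 ↔ z.2 = 0 := by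
    constructor
    · intro h0
      have h1 : D.isotopy.toFun s z = ((D.isotopy.toFun s z).1, 0) := by ext <;> simp [h0]
      have h2 : D.isotopy.toFun s z = D.isotopy.toFun s ((D.isotopy.toFun s z).1, 0) := by
        rw [D.isotopy_zero_section]; exact h1
      rw [(D.isotopy.bijective s).1 h2]
    · intro h0
      have hzz : z = (z.1, 0) := by ext <;> simp [h0]
      rw [hzz, D.isotopy_zero_section]
  constructor
  · intro h
    rcases lt_trichotomy z.2 0 with h' | h' | h'
    · exact h'
    · exact absurd (hzero.2 h') h.ne
    · exact absurd (hpos.2 h') (not_lt.2 h.le)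
  · intro h
    rcases lt_trichotomy (D.isotopy.toFun s z).2 0 with h' | h' | h'
    · exact h'
    · exact absurd (hzero.1 h') h.ne
    · exact absurd (hpos.1 h') (not_lt.2 h.le)

end MoserData

/-! ### The discharge -/

/-- **The origami normal form of the fold** (Cannas da Silva–Guillemin–Woodward 2000, Thm. 1;
discharge of the named fact `exists_origamiCollarNormalForm`).  Proof: kernel-adapted collar
`c₀`, re-oriented null action and connection form `α`, Moser data of the segment to the model
form, Moser isotopy `Ψ` with `Ψ₁^* ω₁ = c₀^*ω` near the fold, and `c = c₀ ∘ Ψ₁⁻¹`.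
[cite: CannasGuilleminWoodward2000, Thm. 1] -/
theorem exists_origamiCollarNormalForm_holds : exists_origamiCollarNormalForm.{u} := by
  intro M _ _ _ _ _ _ o so hs
  obtain ⟨N, tN, cN, mN, kN, j, θ, ⟨hf, hθ, h1, hmul, hfree, htan⟩, f, U, hreg, hf0, hfpos, hfneg,
    hUker, hinj, himg, hft, hbij, hsm, hcl, hnd, hvert, hhor⟩ := hs.exists_kernelAdaptedCollar o
  haveI : T2Space N := hf.embedding.isEmbedding.t2Space
  have hj : ContMDiff (𝓡 3) (𝓡 4) ∞ j := hf.embedding.contMDiff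
  have hf0' : ∀ x ∈ fold so, f x = 0 := by
    intro x hx
    have : x ∈ f ⁻¹' {0} := by rw [hf0]; exact hx
    exact this
  have hUj : ∀ (n : N) (w : TangentSpace (𝓡 4) (j n)), so (j n) ![U.ξ (j n), w] = 0 :=
    fun n w => hUker (j n) (hf.range_eq ▸ mem_range_self n) w
  -- the first-order coefficient of the given action and the re-oriented action
  set g : N → ℝ := fun n => deriv (fun t : ℝ => (so.pullback I34 (foldCollar U j)) (n, t)
      ![(((0 : E3), (1 : ℝ)) : F4), ((mfderiv 𝓘(ℝ, ℝ) (𝓡 3) (fun t : ℝ => θ (Circle.exp t) n) 0 (1 : ℝ) : E3),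
        (0 : ℝ))]) 0 with hg
  have hgc : Continuous g := continuous_deriv_pullback_foldCollar_orbit hf hθ h1 U
  have hg0 : ∀ n, g n ≠ 0 := fun n =>
    hf.deriv_pullback_foldCollar_orbit_ne_zero hθ h1 hmul hfree htan U hf0' hUker n
  set θ' : Circle → N → N := flipAct θ g with hθ'def
  have hθ' : ContMDiff ((𝓡 1).prod (𝓡 3)) (𝓡 3) ∞ (fun p : Circle × N => θ' p.1 p.2) :=
    contMDiff_flipAct hθ hgc hg0
  have h1' : ∀ n, θ' 1 n = n := flipAct_one h1 g
  have hmul' : ∀ a b n, θ' (a * b) n = θ' a (θ' b n) := flipAct_mul hθ h1 hmul hgc hg0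
  have hfree' : ∀ a n, θ' a n = n → a = 1 := flipAct_free hfree g
  -- orbit velocities
  set X : N → E3 := fun n => mfderiv 𝓘(ℝ, ℝ) (𝓡 3) (fun t : ℝ => θ (Circle.exp t) n) 0 (1 : ℝ) with hXdef
  set X' : N → E3 := fun n => mfderiv 𝓘(ℝ, ℝ) (𝓡 3) (fun t : ℝ => θ' (Circle.exp t) n) 0 (1 : ℝ) with hX'def
  set ε : N → ℝ := fun n => if 0 < g n then (1 : ℝ) else -1 with hεdef
  have hXX' : ∀ n, X' n = ε n • X n := fun n => mfderiv_flipAct_orbit hθ g n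
  have hε2 : ∀ n, ε n * ε n = 1 := fun n => by
    simp only [hεdef]; split_ifs <;> norm_num
  have hεg : ∀ n, 0 < ε n * g n := fun n => by
    simp only [hεdef]; split_ifs with h
    · linarith
    · have : g n < 0 := lt_of_le_of_ne (not_lt.1 h) (hg0 n); nlinarith
  have hXne : ∀ n, X n ≠ 0 := fun n =>
    mfderiv_circleOrbit_apply_one_ne_zero (θ := θ) hθ h1 hmul hfree n
  have hX'ne : ∀ n, X' n ≠ 0 := fun n => by
    rw [hXX']
    intro h
    rcases smul_eq_zero.1 h with h' | h'
    · have := hε2 n; rw [h', zero_mul] at this; exact zero_ne_one this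
    · exact hXne n h'
  -- tangency of the re-oriented action to `ker ω`
  have htan' : ∀ (n : N) (w : TangentSpace (𝓡 4) (j n)),
      so (j n) ![mfderiv 𝓘(ℝ, ℝ) (𝓡 4) (fun t : ℝ => j (θ' (Circle.exp t) n)) 0 (1 : ℝ), w] = 0 := by
    intro n w
    rw [mfderiv_comp_circleOrbit_apply hj hθ' h1' n]
    show so (j n) ![mfderiv (𝓡 3) (𝓡 4) j n (X' n), w] = 0
    have hlin : (mfderiv (𝓡 3) (𝓡 4) j n) (ε n • X n) = ε n • (mfderiv (𝓡 3) (𝓡 4) j n) (X n) :=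
      map_smul _ _ _
    rw [hXX', hlin, (so (j n)).vecCons_smul ![w] (ε n)]
    have h0 : so (j n) ![mfderiv (𝓡 3) (𝓡 4) j n (X n), w] = 0 := by
      rw [hXdef, ← mfderiv_comp_circleOrbit_apply hj hθ h1 n]; exact htan n w
    rw [h0, smul_zero]
  -- the circle action as a `MulAction` and a connection form
  letI : MulAction Circle N := circleMulAction θ' h1' hmul'
  have hθ'' : ContMDiff ((𝓡 1).prod (𝓡 3)) (𝓡 3) ∞ (fun x : Circle × N => x.1 • x.2) := hθ'
  have hfree'' : ∀ (a : Circle) (x : N), a • x = x → a = 1 := hfree'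
  obtain ⟨α, hαs, hαi, hαX, -⟩ := exists_circleConnectionForm (m := 3) hθ'' hfree''
  have hαX' : ∀ n, α n ![X' n] = 1 := hαX
  -- the forms
  set c₀ : N × ℝ → M := foldCollar U j with hc₀def
  have hc₀s : ContMDiff I34 (𝓡 4) ∞ c₀ := contMDiff_foldCollar U hj
  set Ω₀ : MForm I34 (N × ℝ) ℝ 2 := so.pullback I34 c₀ with hΩ₀def
  set ωZ : MForm (𝓡 3) N ℝ 2 := so.pullback (𝓡 3) j with hωZdef
  have hωZs : IsSmoothForm ωZ := Literature.NumberTheory.Transcendental.isSmoothForm_pullback hj hf.smooth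
  have hωZc : IsClosedForm ωZ := by
    have h0 : mextDeriv so = 0 := hf.closed
    show mextDeriv (so.pullback (𝓡 3) j) = 0
    rw [Literature.NumberTheory.Transcendental.mextDeriv_pullback hj hf.smooth, h0, MForm.pullback_zero]
  have hnull : ∀ (n : N) (v : E3), (∀ w, ωZ n ![v, w] = 0) ↔ ∃ c : ℝ, v = c • X' n :=
    fun n v => hf.null_iff_exists_eq_smul hθ' h1' hmul' hfree' htan' n v
  have hagree : ∀ n, Ω₀ (n, 0) = modelF ωZ α (n, 0) := fun n =>
    pullback_foldCollar_zero_eq_modelForm U hj hUj hαs n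
  -- positivity of the first-order coefficient for the re-oriented action
  have hpos : ∀ n, 0 < deriv (fun t : ℝ => Ω₀ (n, t) ![vVec, ((X' n, 0) : F4)]) 0 := by
    intro n
    have hfun : (fun t : ℝ => Ω₀ (n, t) ![vVec, ((X' n, 0) : F4)]) =
        fun t : ℝ => ε n * (fun t : ℝ => Ω₀ (n, t) ![vVec, ((X n, 0) : F4)]) t := by
      funext t
      have hv : ((X' n, 0) : F4) = ε n • ((X n, 0) : F4) := by
        rw [hXX', Prod.smul_mk, smul_zero]
      show fibreCurve Ω₀ n t ![vVec, ((X' n, 0) : F4)] = ε n * fibreCurve Ω₀ n t ![vVec, ((X n, 0) : F4)]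
      rw [hv, alt2_smul_right']
    rw [hfun, deriv_const_mul_field']
    exact hεg n
  -- the Moser data and the isotopy
  obtain ⟨D, hDΩ, hD1, hDX⟩ := exists_moserData_of_collar hsm hcl hωZs hωZc hαs hαX' hX'ne hnull hagree
    hvert hhor hpos
  set ψ := D.isotopy.toDiffeomorph 1 with hψdef
  have hψ : ∀ z, ψ z = D.isotopy.toFun 1 z := fun z => rfl
  have hψ0 : ∀ n : N, ψ.symm (n, 0) = (n, 0) := fun n => by
    have h : ψ (n, 0) = (n, 0) := D.isotopy_zero_section 1 n
    calc ψ.symm (n, 0) = ψ.symm (ψ (n, 0)) := by rw [h]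
      _ = (n, 0) := ψ.symm_apply_apply _
  -- the thin band on which everything holds
  set δ' : ℝ := min U.δ D.band with hδ'
  have hδ'pos : 0 < δ' := lt_min U.δ_pos D.band_pos
  set W : Set (ℝ × (N × ℝ)) := (univ : Set ℝ) ×ˢ (ψ.symm ⁻¹' {z : N × ℝ | |z.2| < δ'}) with hW
  have hWo : IsOpen W :=
    isOpen_univ.prod ((isOpen_lt (continuous_abs.comp continuous_snd) continuous_const).preimage
      ψ.symm.continuous)
  have hWsub : ∀ s ∈ Icc (0 : ℝ) 0, ∀ n : N, ((s, (n, (0 : ℝ))) : ℝ × (N × ℝ)) ∈ W := by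
    intro s _ n
    refine ⟨mem_univ _, ?_⟩
    show |(ψ.symm (n, 0)).2| < δ'
    rw [hψ0]; simpa using hδ'pos
  obtain ⟨δ, hδ, hδW⟩ := exists_margin hWo le_rfl hWsub
  have hin : ∀ (n : N) (t : ℝ), |t| < δ → |(ψ.symm (n, t)).2| < δ' := by
    intro n t ht
    have h := hδW 0 ⟨by linarith, by linarith⟩ n t ht
    exact h.2
  -- the collar
  set c : N × ℝ → M := c₀ ∘ ψ.symm with hcdef
  have hψ's : ContMDiff I34 I34 ∞ ψ.symm := ψ.symm.contMDiff
  have hcs : ContMDiff I34 (𝓡 4) ∞ c := hc₀s.comp hψ's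
  have hband : ∀ (n : N) (t : ℝ), t ∈ Ioo (-δ) δ → (ψ.symm (n, t)) ∈ (univ : Set N) ×ˢ Ioo (-U.δ) U.δ ∧
      |(ψ.symm (n, t)).2| < D.band := by
    intro n t ht
    have h := hin n t (abs_lt.2 ⟨ht.1, ht.2⟩)
    refine ⟨⟨mem_univ _, ?_⟩, lt_of_lt_of_le h (min_le_right _ _)⟩
    have h' := lt_of_lt_of_le h (min_le_left _ _)
    exact abs_lt.1 h'
  refine ⟨N, tN, cN, mN, kN, j, θ', α, c, δ, hf, hθ', h1', hmul', hfree', htan', hαs, hαi, hαX, hδ,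
    hcs.contMDiffOn, fun n => ?_, ?_, ?_, ?_, ?_, ?_⟩
  · -- `c (n, 0) = j n`
    show c₀ (ψ.symm (n, 0)) = j n
    rw [hψ0, hc₀def, foldCollar_zero]
  · -- injectivity on the band
    rintro ⟨n, t⟩ ⟨-, ht⟩ ⟨n', t'⟩ ⟨-, ht'⟩ h
    have h1 := hinj (hband n t ht).1 (hband n' t' ht').1 h
    exact ψ.symm.injective h1
  · -- the image of the band is open
    have himage : c '' ((univ : Set N) ×ˢ Ioo (-δ) δ) = c₀ '' (ψ.symm '' ((univ : Set N) ×ˢ Ioo (-δ) δ)) := by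
      rw [hcdef, image_comp]
    rw [himage]
    have hO : IsOpen (ψ.symm '' ((univ : Set N) ×ˢ Ioo (-δ) δ)) :=
      ψ.symm.toHomeomorph.isOpenMap _ (isOpen_univ.prod isOpen_Ioo)
    refine isOpen_image_of_bijective_mfderiv hO hc₀s.contMDiffOn ?_
    rintro _ ⟨⟨n, t⟩, ⟨-, ht⟩, rfl⟩
    have hb := (hband n t ht).1
    exact hbij _ _ hb.2
  · -- bijective differential
    intro n t ht
    have hb := (hband n t ht).1
    have hmd₀ : MDifferentiableAt I34 (𝓡 4) c₀ (ψ.symm (n, t)) := (hc₀s _).mdifferentiableAt (by simp)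
    have hmd' : MDifferentiableAt I34 I34 ψ.symm (n, t) := (hψ's _).mdifferentiableAt (by simp)
    rw [hcdef, mfderiv_comp _ hmd₀ hmd']
    have h : Bijective (mfderiv I34 I34 ψ.symm (n, t)) :=
      (ψ.symm.mfderivToContinuousLinearEquiv (by simp) (n, t)).bijective
    exact (hbij _ _ hb.2).comp h
  · -- the two sides
    intro n t ht
    have htband : t ∈ Ioo (-δ) δ := ⟨by linarith [ht.1], ht.2⟩
    have htband' : -t ∈ Ioo (-δ) δ := ⟨by linarith [ht.2], by linarith [ht.1]⟩
    constructor
    · have hb := (hband n t htband).1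
      have hsgn : 0 < (ψ.symm (n, t)).2 := by
        have h := D.isotopy_snd_pos_iff 1 (ψ.symm (n, t))
        rw [← hψ, ψ.apply_symm_apply] at h
        exact h.1 ht.1
      have hfval : f (c (n, t)) = (ψ.symm (n, t)).2 := by
        show f (c₀ (ψ.symm (n, t))) = _
        have := hft (ψ.symm (n, t)).1 (ψ.symm (n, t)).2 hb.2
        exact this
      have hmem : c (n, t) ∈ {x : M | 0 < f x} := by show 0 < f (c (n, t)); rw [hfval]; exact hsgn
      rwa [hfpos] at hmem
    · have hb := (hband n (-t) htband').1
      have hsgn : (ψ.symm (n, -t)).2 < 0 := by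
        have h := D.isotopy_snd_neg_iff 1 (ψ.symm (n, -t))
        rw [← hψ, ψ.apply_symm_apply] at h
        exact h.1 (by show -t < 0; linarith [ht.1])
      have hfval : f (c (n, -t)) = (ψ.symm (n, -t)).2 := by
        show f (c₀ (ψ.symm (n, -t))) = _
        exact hft (ψ.symm (n, -t)).1 (ψ.symm (n, -t)).2 hb.2
      have hmem : c (n, -t) ∈ {x : M | f x < 0} := by show f (c (n, -t)) < 0; rw [hfval]; exact hsgn
      rwa [hfneg] at hmem
  · -- the normal form
    rintro ⟨n, t⟩ ⟨-, ht⟩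
    have hb := hband n t ht
    have hψd : MDifferentiable I34 I34 ψ := ψ.contMDiff.mdifferentiable (by simp)
    have hψ'd : MDifferentiable I34 I34 ψ.symm := hψ's.mdifferentiable (by simp)
    have hc₀d : MDifferentiable I34 (𝓡 4) c₀ := hc₀s.mdifferentiable (by simp)
    have hstep1 : so.pullback I34 c (n, t) = (Ω₀.pullback I34 ψ.symm) (n, t) := by
      rw [hcdef, MForm.pullback_comp hc₀d hψ'd]
    have hstep2 : Ω₀ (ψ.symm (n, t)) = ((D.Ωs 1).pullback I34 ψ) (ψ.symm (n, t)) := by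
      set z := ψ.symm (n, t) with hz
      have hz2 : |z.2| < D.band := hb.2
      have h := D.pullback_isotopy_one z.1 hz2
      rw [hDΩ] at h
      have hzz : z = (z.1, z.2) := by simp
      rw [hzz]
      exact h.symm
    have hstep3 : (Ω₀.pullback I34 ψ.symm) (n, t) = (((D.Ωs 1).pullback I34 ψ).pullback I34 ψ.symm) (n, t) := by
      ext V
      show Ω₀ (ψ.symm (n, t)) (fun i => mfderiv I34 I34 ψ.symm (n, t) (V i)) =
        ((D.Ωs 1).pullback I34 ψ) (ψ.symm (n, t)) (fun i => mfderiv I34 I34 ψ.symm (n, t) (V i))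
      rw [hstep2]
    have hstep4 : (((D.Ωs 1).pullback I34 ψ).pullback I34 ψ.symm) (n, t) = (D.Ωs 1) (n, t) := by
      rw [← MForm.pullback_comp hψd hψ'd]
      have hid : ((ψ : N × ℝ → N × ℝ) ∘ (ψ.symm : N × ℝ → N × ℝ)) = id := funext fun y => ψ.apply_symm_apply y
      rw [hid, MForm.pullback_id]
    rw [hstep1, hstep3, hstep4, hD1]
    rfl

end OrigamiMoser

/-- **Discharge of the named fact `exists_origamiCollarNormalForm`** (root-level alias).
[cite: CannasGuilleminWoodward2000, Thm. 1] -/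
theorem exists_origamiCollarNormalForm_holds : exists_origamiCollarNormalForm.{u} :=
  OrigamiMoser.exists_origamiCollarNormalForm_holds

end Literature.Geometry.Symplectic

end
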